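import Summits.CriticalPhenomena.CardyFormulaZ2.Theorems.CardyIKTransportIKMixedBoxCrossingTransportDefs
import Summits.CriticalPhenomena.CardyFormulaZ2.Theorems.CardyIKTransportIKLinearTransportDiagramExchangeGlue

/-!
# `stub_slabDeterminacy` (crux `IKMixedBoxCrossing`, stmt-CriticalPhenomena-5911; line `defect-closure-exploration`,
# reshape v4, lead c4)

The registered stub `stub_slabDeterminacy : SlabDeterminacy` of `…TransportDefs` §3: on the cylinder slab
`Fin (w+1) × ℤ/L`, black connectivity inside the slab between two cells OFF the interior cell column `i + 1`
(here: two cells of the left column, the transported event `arcsEvent w L n`) is determined by the colours off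
that column, the flags off the face columns `i, i + 1`, and the block diagram `blockDiag L i hi` of the three-column
block at cell columns `i, i + 1, i + 2`.

Proof (pure path combinatorics, every `L`, no `NeZero`). Colours are absorbed into graphs: black connectivity
from a black cell is reachability in `cylGraph w L x.2 ⊓ monoGraph x.1` (`blackConn_iff`). Every edge of the
slab triangulation joins equal or adjacent cell columns (`adj_col`), so this graph is the join CONTEXT ⊔ PATCH of
its restriction off cell column `i + 1` and its restriction to the cell columns `i, i + 1, i + 2`
(`eq_ctx_sup_patch`). The context graphs of the two configurations coincide (`ctx_eq`: an edge between cells off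
column `i + 1` reads only flags off face columns `i, i + 1`, `adj_congr`). The patch graph, read in block
coordinates, IS the monochromatic block graph of the block data `blockCol`, `blockFlg` (`adj_shift`,
`patch_reachable_iff`), so its reachability between block-boundary cells is recorded by the block diagram. The
landed GLUING THEOREM `reachable_glue_congr` (`…IKLinearTransportDiagramExchangeGlue` §3: a patch enters the
reachability between cells outside its interior only through the reachability it induces on its boundary) then
exchanges the two patches (`blackConn_congr`).
-/

namespace Summit.CriticalPhenomena.CardyFormulaZ2.Cruxes.IKMixedBoxCrossing.DefectClosureExploration

open Summit.CriticalPhenomena.CardyFormulaZ2.Theorems.IKLinearTransport.PinnedDiagramExchange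
  (blockGraph blockCluster blockDiagram monoGraph monoGraph_adj mem_blockCluster_iff reachable_glue_congr)

namespace SlabDetStub

variable {w L : ℕ}

/-! ## §1 The slab triangulation: column steps, locality of the edges, the block as a shifted copy -/

/-- Adjacent cells of the slab triangulation lie in equal or adjacent cell columns. -/
theorem adj_col {flg : Fin w × ZMod L → Bool} {u v : Fin (w + 1) × ZMod L}
    (h : (cylGraph w L flg).Adj u v) :
    v.1.val = u.1.val + 1 ∨ v.1.val = u.1.val ∨ u.1.val = v.1.val + 1 := by
  simp only [cylGraph, SimpleGraph.fromRel_adj] at h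
  rcases h.2 with (h | h | ⟨j, h1, h2, -⟩ | ⟨j, h1, h2, -⟩) | (h | h | ⟨j, h1, h2, -⟩ | ⟨j, h1, h2, -⟩)
  · exact Or.inr (Or.inl (by rw [h.1]))
  · exact Or.inl h.1
  · refine Or.inl ?_
    rw [h1, h2, Fin.val_succ, Fin.val_castSucc]
  · refine Or.inl ?_
    rw [h1, h2, Fin.val_succ, Fin.val_castSucc]
  · exact Or.inr (Or.inl (by rw [h.1]))
  · exact Or.inr (Or.inr h.1)
  · refine Or.inr (Or.inr ?_)
    rw [h1, h2, Fin.val_succ, Fin.val_castSucc]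
  · refine Or.inr (Or.inr ?_)
    rw [h1, h2, Fin.val_succ, Fin.val_castSucc]

/-- LOCALITY OF THE EDGES (one orientation of the edge relation of `cylGraph`): between two cells off cell column
`i + 1` the relation reads only flags off the face columns `i, i + 1`. -/
theorem rel_congr {i : ℕ} {flg flg' : Fin w × ZMod L → Bool}
    (hF : ∀ f : Fin w × ZMod L, f.1.val ≠ i → f.1.val ≠ i + 1 → flg f = flg' f)
    {u v : Fin (w + 1) × ZMod L} (hu : u.1.val ≠ i + 1) (hv : v.1.val ≠ i + 1)
    (h : (v.1 = u.1 ∧ v.2 = u.2 + 1) ∨ (v.1.val = u.1.val + 1 ∧ v.2 = u.2) ∨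
      (∃ j : Fin w, u.1 = j.castSucc ∧ v.1 = j.succ ∧ v.2 = u.2 + 1 ∧ flg (j, u.2) = false) ∨
      (∃ j : Fin w, u.1 = j.castSucc ∧ v.1 = j.succ ∧ u.2 = v.2 + 1 ∧ flg (j, v.2) = true)) :
    (v.1 = u.1 ∧ v.2 = u.2 + 1) ∨ (v.1.val = u.1.val + 1 ∧ v.2 = u.2) ∨
      (∃ j : Fin w, u.1 = j.castSucc ∧ v.1 = j.succ ∧ v.2 = u.2 + 1 ∧ flg' (j, u.2) = false) ∨
      (∃ j : Fin w, u.1 = j.castSucc ∧ v.1 = j.succ ∧ u.2 = v.2 + 1 ∧ flg' (j, v.2) = true) := by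
  rcases h with h | h | ⟨j, h1, h2, h3, h4⟩ | ⟨j, h1, h2, h3, h4⟩
  · exact Or.inl h
  · exact Or.inr (Or.inl h)
  · have hj1 : u.1.val = j.val := by rw [h1, Fin.val_castSucc]
    have hj2 : v.1.val = j.val + 1 := by rw [h2, Fin.val_succ]
    refine Or.inr (Or.inr (Or.inl ⟨j, h1, h2, h3, ?_⟩))
    rw [← hF (j, u.2) (show j.val ≠ i by omega) (show j.val ≠ i + 1 by omega)]
    exact h4
  · have hj1 : u.1.val = j.val := by rw [h1, Fin.val_castSucc]
    have hj2 : v.1.val = j.val + 1 := by rw [h2, Fin.val_succ]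
    refine Or.inr (Or.inr (Or.inr ⟨j, h1, h2, h3, ?_⟩))
    rw [← hF (j, v.2) (show j.val ≠ i by omega) (show j.val ≠ i + 1 by omega)]
    exact h4

/-- Two flag fields agreeing off the face columns `i, i + 1` define the same edges between cells off cell column
`i + 1`. -/
theorem adj_congr {i : ℕ} {flg flg' : Fin w × ZMod L → Bool}
    (hF : ∀ f : Fin w × ZMod L, f.1.val ≠ i → f.1.val ≠ i + 1 → flg f = flg' f)
    {u v : Fin (w + 1) × ZMod L} (hu : u.1.val ≠ i + 1) (hv : v.1.val ≠ i + 1) :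
    (cylGraph w L flg).Adj u v ↔ (cylGraph w L flg').Adj u v := by
  have hF' : ∀ f : Fin w × ZMod L, f.1.val ≠ i → f.1.val ≠ i + 1 → flg' f = flg f :=
    fun f h1 h2 => (hF f h1 h2).symm
  simp only [cylGraph, SimpleGraph.fromRel_adj]
  constructor
  · rintro ⟨hne, h⟩
    exact ⟨hne, h.imp (rel_congr hF hu hv) (rel_congr hF hv hu)⟩
  · rintro ⟨hne, h⟩
    exact ⟨hne, h.imp (rel_congr hF' hu hv) (rel_congr hF' hv hu)⟩

/-- THE BLOCK AS A SHIFTED COPY (one orientation of the edge relation): the relation of a slab of `w'` face columns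
whose flags are those of the face columns `i, …, i + w' - 1` of a slab of `w` face columns is the latter's relation
between the cells shifted by `i` columns. -/
theorem rel_shift {w' i : ℕ} {flg : Fin w × ZMod L → Bool} {flg' : Fin w' × ZMod L → Bool}
    (hF : ∀ (j : Fin w') (r : ZMod L) (h : i + j.val < w), flg (⟨i + j.val, h⟩, r) = flg' (j, r))
    {u v : Fin (w + 1) × ZMod L} {c c' : Fin (w' + 1) × ZMod L}
    (hu : u.1.val = i + c.1.val) (hu' : u.2 = c.2) (hv : v.1.val = i + c'.1.val) (hv' : v.2 = c'.2) :
    ((v.1 = u.1 ∧ v.2 = u.2 + 1) ∨ (v.1.val = u.1.val + 1 ∧ v.2 = u.2) ∨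
      (∃ j : Fin w, u.1 = j.castSucc ∧ v.1 = j.succ ∧ v.2 = u.2 + 1 ∧ flg (j, u.2) = false) ∨
      (∃ j : Fin w, u.1 = j.castSucc ∧ v.1 = j.succ ∧ u.2 = v.2 + 1 ∧ flg (j, v.2) = true)) ↔
    ((c'.1 = c.1 ∧ c'.2 = c.2 + 1) ∨ (c'.1.val = c.1.val + 1 ∧ c'.2 = c.2) ∨
      (∃ j : Fin w', c.1 = j.castSucc ∧ c'.1 = j.succ ∧ c'.2 = c.2 + 1 ∧ flg' (j, c.2) = false) ∨
      (∃ j : Fin w', c.1 = j.castSucc ∧ c'.1 = j.succ ∧ c.2 = c'.2 + 1 ∧ flg' (j, c'.2) = true)) := by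
  rw [hu', hv']
  constructor
  · rintro (⟨h1, h2⟩ | ⟨h1, h2⟩ | ⟨j, h1, h2, h3, h4⟩ | ⟨j, h1, h2, h3, h4⟩)
    · have := congrArg Fin.val h1
      exact Or.inl ⟨Fin.ext (by omega), h2⟩
    · exact Or.inr (Or.inl ⟨by omega, h2⟩)
    · have hj1 : u.1.val = j.val := by rw [h1, Fin.val_castSucc]
      have hj2 : v.1.val = j.val + 1 := by rw [h2, Fin.val_succ]
      have hc : c.1.val < w' := by omega
      have hj : (⟨i + c.1.val, by omega⟩ : Fin w) = j := Fin.ext (show i + c.1.val = j.val by omega)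
      rw [← hj] at h4
      refine Or.inr (Or.inr (Or.inl ⟨⟨c.1.val, hc⟩, Fin.ext rfl, Fin.ext (show c'.1.val = c.1.val + 1 by omega),
        h3, ?_⟩))
      rw [← hF ⟨c.1.val, hc⟩ c.2 (show i + c.1.val < w by omega)]
      exact h4
    · have hj1 : u.1.val = j.val := by rw [h1, Fin.val_castSucc]
      have hj2 : v.1.val = j.val + 1 := by rw [h2, Fin.val_succ]
      have hc : c.1.val < w' := by omega
      have hj : (⟨i + c.1.val, by omega⟩ : Fin w) = j := Fin.ext (show i + c.1.val = j.val by omega)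
      rw [← hj] at h4
      refine Or.inr (Or.inr (Or.inr ⟨⟨c.1.val, hc⟩, Fin.ext rfl, Fin.ext (show c'.1.val = c.1.val + 1 by omega),
        h3, ?_⟩))
      rw [← hF ⟨c.1.val, hc⟩ c'.2 (show i + c.1.val < w by omega)]
      exact h4
  · rintro (⟨h1, h2⟩ | ⟨h1, h2⟩ | ⟨j, h1, h2, h3, h4⟩ | ⟨j, h1, h2, h3, h4⟩)
    · have := congrArg Fin.val h1
      exact Or.inl ⟨Fin.ext (by omega), h2⟩
    · exact Or.inr (Or.inl ⟨by omega, h2⟩)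
    · have hj1 : c.1.val = j.val := by rw [h1, Fin.val_castSucc]
      have hj2 : c'.1.val = j.val + 1 := by rw [h2, Fin.val_succ]
      have hj : i + j.val < w := by omega
      refine Or.inr (Or.inr (Or.inl ⟨⟨i + j.val, hj⟩, Fin.ext (show u.1.val = i + j.val by omega),
        Fin.ext (show v.1.val = i + j.val + 1 by omega), h3, ?_⟩))
      rw [hF j c.2 hj]
      exact h4
    · have hj1 : c.1.val = j.val := by rw [h1, Fin.val_castSucc]
      have hj2 : c'.1.val = j.val + 1 := by rw [h2, Fin.val_succ]
      have hj : i + j.val < w := by omega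
      refine Or.inr (Or.inr (Or.inr ⟨⟨i + j.val, hj⟩, Fin.ext (show u.1.val = i + j.val by omega),
        Fin.ext (show v.1.val = i + j.val + 1 by omega), h3, ?_⟩))
      rw [hF j c'.2 hj]
      exact h4

/-- The slab triangulation between cells shifted by `i` columns is the triangulation of the shifted copy. -/
theorem adj_shift {w' i : ℕ} {flg : Fin w × ZMod L → Bool} {flg' : Fin w' × ZMod L → Bool}
    (hF : ∀ (j : Fin w') (r : ZMod L) (h : i + j.val < w), flg (⟨i + j.val, h⟩, r) = flg' (j, r))
    {u v : Fin (w + 1) × ZMod L} {c c' : Fin (w' + 1) × ZMod L}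
    (hu : u.1.val = i + c.1.val) (hu' : u.2 = c.2) (hv : v.1.val = i + c'.1.val) (hv' : v.2 = c'.2) :
    (cylGraph w L flg).Adj u v ↔ (cylGraph w' L flg').Adj c c' := by
  have hne : u ≠ v ↔ c ≠ c' := by
    constructor
    · rintro h rfl
      exact h (Prod.ext (Fin.ext (by omega)) (hu'.trans hv'.symm))
    · rintro h huv
      subst huv
      exact h (Prod.ext (Fin.ext (by omega)) (hu'.symm.trans hv'))
  simp only [cylGraph, SimpleGraph.fromRel_adj]
  constructor
  · rintro ⟨h0, h⟩
    exact ⟨hne.1 h0, h.imp (rel_shift hF hu hu' hv hv').1 (rel_shift hF hv hv' hu hu').1⟩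
  · rintro ⟨h0, h⟩
    exact ⟨hne.2 h0, h.imp (rel_shift hF hu hu' hv hv').2 (rel_shift hF hv hv' hu hu').2⟩

/-! ## §2 Black connectivity as monochromatic reachability; context ⊔ patch -/

/-- Black connectivity is: the first cell is black and the two cells are joined in the slab triangulation cut
down to its equal-colour edges. -/
theorem blackConn_iff (x : CylCfg w L) (u v : Fin (w + 1) × ZMod L) :
    BlackConn x u v ↔ x.1 u = true ∧ (cylGraph w L x.2 ⊓ monoGraph x.1).Reachable u v := by
  constructor
  · rintro ⟨hu, hv, hr⟩
    let φ : (cylGraph w L x.2).induce {z | x.1 z = true} →g cylGraph w L x.2 ⊓ monoGraph x.1 :=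
      { toFun := fun z => z.1
        map_rel' := fun {a b} hab => by
          rw [SimpleGraph.inf_adj, monoGraph_adj]
          exact ⟨hab, fun heq => hab.ne (Subtype.ext heq), a.2.trans b.2.symm⟩ }
    exact ⟨hu, hr.map φ⟩
  · rintro ⟨hu, hr⟩
    rw [SimpleGraph.reachable_iff_reflTransGen] at hr
    induction hr with
    | refl => exact ⟨hu, hu, SimpleGraph.Reachable.refl _⟩
    | @tail b c _ hbc ih =>
      obtain ⟨_, hb, hrb⟩ := ih
      rw [SimpleGraph.inf_adj, monoGraph_adj] at hbc
      have hc : x.1 c = true := hbc.2.2.symm.trans hb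
      refine ⟨hu, hc, hrb.trans (SimpleGraph.Adj.reachable ?_)⟩
      exact hbc.1

/-- Adjacency of the restriction of a graph to a vertex set (vertices off the set isolated). -/
theorem res_adj {V : Type*} (G : SimpleGraph V) (s : Set V) (u v : V) :
    ((⊤ : G.Subgraph).induce s).spanningCoe.Adj u v ↔ u ∈ s ∧ v ∈ s ∧ G.Adj u v := Iff.rfl

/-- CONTEXT ⊔ PATCH: a graph on the slab cells whose edges join equal or adjacent cell columns is the join of its
restriction off cell column `i + 1` and its restriction to the cell columns `i, i + 1, i + 2`. -/
theorem eq_ctx_sup_patch (G : SimpleGraph (Fin (w + 1) × ZMod L)) (i : ℕ)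
    (hG : ∀ u v, G.Adj u v → v.1.val = u.1.val + 1 ∨ v.1.val = u.1.val ∨ u.1.val = v.1.val + 1) :
    G = ((⊤ : G.Subgraph).induce {v | v.1.val ≠ i + 1}).spanningCoe ⊔
      ((⊤ : G.Subgraph).induce {v | i ≤ v.1.val ∧ v.1.val ≤ i + 2}).spanningCoe := by
  ext u v
  simp only [SimpleGraph.sup_adj, res_adj, Set.mem_setOf_eq]
  constructor
  · intro hadj
    by_cases huv : u.1.val ≠ i + 1 ∧ v.1.val ≠ i + 1
    · exact Or.inl ⟨huv.1, huv.2, hadj⟩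
    · have := hG u v hadj
      refine Or.inr ⟨⟨?_, ?_⟩, ⟨?_, ?_⟩, hadj⟩ <;> omega
  · rintro (⟨-, -, h⟩ | ⟨-, -, h⟩) <;> exact h

/-- Off cell column `i + 1`, the CONTEXT graphs of two configurations with the same colours off that column and
the same flags off the face columns `i, i + 1` coincide. -/
theorem ctx_eq {i : ℕ} {x y : CylCfg w L} (hcol : ∀ c : Fin (w + 1) × ZMod L, c.1.val ≠ i + 1 → x.1 c = y.1 c)
    (hflg : ∀ f : Fin w × ZMod L, f.1.val ≠ i → f.1.val ≠ i + 1 → x.2 f = y.2 f) :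
    ((⊤ : (cylGraph w L x.2 ⊓ monoGraph x.1).Subgraph).induce {v | v.1.val ≠ i + 1}).spanningCoe =
      ((⊤ : (cylGraph w L y.2 ⊓ monoGraph y.1).Subgraph).induce {v | v.1.val ≠ i + 1}).spanningCoe := by
  ext u v
  simp only [res_adj, Set.mem_setOf_eq, SimpleGraph.inf_adj, monoGraph_adj]
  constructor
  · rintro ⟨hu, hv, hadj, hne, hc⟩
    refine ⟨hu, hv, (adj_congr hflg hu hv).1 hadj, hne, ?_⟩
    rw [← hcol u hu, ← hcol v hv]
    exact hc
  · rintro ⟨hu, hv, hadj, hne, hc⟩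
    refine ⟨hu, hv, (adj_congr hflg hu hv).2 hadj, hne, ?_⟩
    rw [hcol u hu, hcol v hv]
    exact hc

/-! ## §3 The patch is the block -/

/-- A cell of the cell columns `i, i + 1, i + 2` in block coordinates. -/
theorem strip_repr {i : ℕ} (hi : i + 1 < w) {v : Fin (w + 1) × ZMod L} (h1 : i ≤ v.1.val)
    (h2 : v.1.val ≤ i + 2) :
    ∃ (a : Fin 3) (r : ZMod L), v = ((⟨i + a.val, by clear h1 h2; omega⟩ : Fin (w + 1)), r) :=
  ⟨⟨v.1.val - i, by omega⟩, v.2, Prod.ext (Fin.ext (show v.1.val = i + (v.1.val - i) by omega)) rfl⟩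

/-- PATCH = BLOCK: reachability in the monochromatic slab graph restricted to the cell columns `i, i + 1, i + 2`,
between cells given in block coordinates, is reachability in the monochromatic block graph of the block data
`blockCol i hi x`, `blockFlg i hi x`. -/
theorem patch_reachable_iff {i : ℕ} (hi : i + 1 < w) (x : CylCfg w L) (a a' : Fin 3) (r r' : ZMod L) :
    ((⊤ : (cylGraph w L x.2 ⊓ monoGraph x.1).Subgraph).induce
        {v | i ≤ v.1.val ∧ v.1.val ≤ i + 2}).spanningCoe.Reachable
        ((⟨i + a.val, by omega⟩ : Fin (w + 1)), r) ((⟨i + a'.val, by omega⟩ : Fin (w + 1)), r') ↔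
      (blockGraph L (blockFlg i hi x) ⊓ monoGraph (blockCol i hi x)).Reachable (a, r) (a', r') := by
  have hK : blockGraph L (blockFlg i hi x) = cylGraph 2 L (blockFlg i hi x) := rfl
  have hF : ∀ (j : Fin 2) (s : ZMod L) (h : i + j.val < w), x.2 (⟨i + j.val, h⟩, s) = blockFlg i hi x (j, s) :=
    fun _ _ _ => rfl
  rw [hK]
  constructor
  · -- read a walk of the patch in block coordinates, edge by edge
    suffices key : ∀ v, ((⊤ : (cylGraph w L x.2 ⊓ monoGraph x.1).Subgraph).induce
        {v | i ≤ v.1.val ∧ v.1.val ≤ i + 2}).spanningCoe.Reachable ((⟨i + a.val, by omega⟩ : Fin (w + 1)), r) v →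
        ∀ (b : Fin 3) (s : ZMod L), v = ((⟨i + b.val, by omega⟩ : Fin (w + 1)), s) →
          (cylGraph 2 L (blockFlg i hi x) ⊓ monoGraph (blockCol i hi x)).Reachable (a, r) (b, s) from
      fun h => key _ h a' r' rfl
    intro v hv
    rw [SimpleGraph.reachable_iff_reflTransGen] at hv
    induction hv with
    | refl =>
      intro b s hbs
      obtain ⟨h1, h2⟩ := Prod.ext_iff.1 hbs
      have h1' := congrArg Fin.val h1
      simp only at h1' h2
      obtain rfl : a = b := Fin.ext (by omega)
      subst h2
      rfl
    | @tail p q _ hpq ih =>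
      intro b s hbs
      obtain ⟨hp, -, hadj⟩ := (res_adj _ _ _ _).1 hpq
      obtain ⟨d, t, rfl⟩ := strip_repr hi hp.1 hp.2
      subst hbs
      rw [SimpleGraph.inf_adj, monoGraph_adj] at hadj
      obtain ⟨hadj, -, hc⟩ := hadj
      have e : (cylGraph 2 L (blockFlg i hi x)).Adj (d, t) (b, s) := (adj_shift hF rfl rfl rfl rfl).1 hadj
      refine (ih d t rfl).trans (SimpleGraph.Adj.reachable ?_)
      rw [SimpleGraph.inf_adj, monoGraph_adj]
      exact ⟨e, e.ne, hc⟩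
  · -- push a walk of the block into the slab along the embedding
    intro h
    let Φ : cylGraph 2 L (blockFlg i hi x) ⊓ monoGraph (blockCol i hi x) →g
        ((⊤ : (cylGraph w L x.2 ⊓ monoGraph x.1).Subgraph).induce
          {v | i ≤ v.1.val ∧ v.1.val ≤ i + 2}).spanningCoe :=
      { toFun := fun c => ((⟨i + c.1.val, by omega⟩ : Fin (w + 1)), c.2)
        map_rel' := fun {c c'} hcc => by
          rw [SimpleGraph.inf_adj, monoGraph_adj] at hcc
          obtain ⟨hadj, -, hc⟩ := hcc
          have e : (cylGraph w L x.2).Adj ((⟨i + c.1.val, by omega⟩ : Fin (w + 1)), c.2)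
              ((⟨i + c'.1.val, by omega⟩ : Fin (w + 1)), c'.2) := (adj_shift hF rfl rfl rfl rfl).2 hadj
          refine (res_adj _ _ _ _).2 ⟨?_, ?_, ?_⟩
          · show i ≤ i + c.1.val ∧ i + c.1.val ≤ i + 2
            constructor <;> omega
          · show i ≤ i + c'.1.val ∧ i + c'.1.val ≤ i + 2
            constructor <;> omega
          rw [SimpleGraph.inf_adj, monoGraph_adj]
          exact ⟨e, e.ne, hc⟩ }
    exact h.map Φ

/-- A block-boundary cell of the slab (cell column `i` or `i + 2`) in block-boundary coordinates (side `0` = block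
column `0` = cell column `i`, side `1` = block column `2` = cell column `i + 2`). -/
theorem bdry_repr {i : ℕ} (hi : i + 1 < w) {p : Fin (w + 1) × ZMod L} (hp : p.1.val = i ∨ p.1.val = i + 2) :
    ∃ (s : Fin 2) (r : ZMod L),
      p = ((⟨i + ((![0, 2] : Fin 2 → Fin 3) s).val, by clear hp; omega⟩ : Fin (w + 1)), r) := by
  rcases hp with h | h
  · exact ⟨0, p.2, Prod.ext (Fin.ext (show p.1.val = i + (0 : Fin 3).val by simp [h])) rfl⟩
  · exact ⟨1, p.2, Prod.ext (Fin.ext (show p.1.val = i + (2 : Fin 3).val by simpa using h)) rfl⟩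

/-! ## §4 Black connectivity off the column is determined off the column given the block diagram -/

/-- BLACK CONNECTIVITY BETWEEN CELLS OFF CELL COLUMN `i + 1` IS DETERMINED OFF THAT COLUMN GIVEN THE BLOCK
DIAGRAM: the gluing theorem `reachable_glue_congr` with interior = cell column `i + 1`, boundary = cell columns
`i, i + 2`, context = the common monochromatic graph off the column, patches = the monochromatic graphs of the
strip, whose boundary reachabilities are the (equal) block diagrams. -/
theorem blackConn_congr {i : ℕ} (hi : i + 1 < w) {x y : CylCfg w L}
    (hcol : ∀ c : Fin (w + 1) × ZMod L, c.1.val ≠ i + 1 → x.1 c = y.1 c)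
    (hflg : ∀ f : Fin w × ZMod L, f.1.val ≠ i → f.1.val ≠ i + 1 → x.2 f = y.2 f)
    (hD : blockDiag L i hi x = blockDiag L i hi y) {u v : Fin (w + 1) × ZMod L}
    (hu : u.1.val ≠ i + 1) (hv : v.1.val ≠ i + 1) : BlackConn x u v ↔ BlackConn y u v := by
  rw [blackConn_iff, blackConn_iff, hcol u hu]
  refine and_congr_right fun _ => ?_
  rw [eq_ctx_sup_patch (cylGraph w L x.2 ⊓ monoGraph x.1) i (fun _ _ h => adj_col h.1),
    eq_ctx_sup_patch (cylGraph w L y.2 ⊓ monoGraph y.1) i (fun _ _ h => adj_col h.1), ctx_eq hcol hflg]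
  refine reachable_glue_congr {v : Fin (w + 1) × ZMod L | v.1.val = i + 1}
    {v : Fin (w + 1) × ZMod L | v.1.val = i ∨ v.1.val = i + 2} _ _ _
    (fun v w h => ((res_adj _ _ _ _).1 h).1) (fun v w h hv => ?_) (fun v w h hv => ?_)
    (fun p q hp hq => ?_) hu hv
  · have h' := ((res_adj _ _ _ _).1 h).1
    simp only [Set.mem_setOf_eq] at h' hv ⊢
    omega
  · have h' := ((res_adj _ _ _ _).1 h).1
    simp only [Set.mem_setOf_eq] at h' hv ⊢
    omega
  · obtain ⟨s, r, rfl⟩ := bdry_repr hi hp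
    obtain ⟨t, r', rfl⟩ := bdry_repr hi hq
    rw [patch_reachable_iff hi x, patch_reachable_iff hi y, ← mem_blockCluster_iff, ← mem_blockCluster_iff]
    show ((s, r), (t, r')) ∈ blockDiag L i hi x ↔ ((s, r), (t, r')) ∈ blockDiag L i hi y
    rw [hD]

end SlabDetStub

open SlabDetStub in
/-- **Registered stub `stub_slabDeterminacy`** (SLAB DETERMINACY, line `defect-closure-exploration`, reshape v4):
black connectivity inside the cylinder slab between cells off the cell column `i + 1` — here the transported event
`arcsEvent w L n` of the left column — is determined by the colours off that column, the flags off the face columns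
`i, i + 1` and the block diagram around the column (a black path splits at its visits to the block into pieces off
the column and block-internal pieces between block-boundary cells, which the diagram records). -/
theorem stub_slabDeterminacy : SlabDeterminacy := by
  intro w L n i hi x y hcol hflg hD
  have h0 : ∀ r : ZMod L, (((0 : Fin (w + 1)), r) : Fin (w + 1) × ZMod L).1.val ≠ i + 1 := fun r => by
    show ((0 : Fin (w + 1)) : ℕ) ≠ i + 1
    rw [Fin.val_zero]
    omega
  simp only [arcsEvent, Set.mem_setOf_eq]
  constructor
  · rintro ⟨r₁, r₂, h1, h2, h3, h4, hB⟩
    exact ⟨r₁, r₂, h1, h2, h3, h4, (blackConn_congr hi hcol hflg hD (h0 r₁) (h0 r₂)).1 hB⟩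
  · rintro ⟨r₁, r₂, h1, h2, h3, h4, hB⟩
    exact ⟨r₁, r₂, h1, h2, h3, h4, (blackConn_congr hi hcol hflg hD (h0 r₁) (h0 r₂)).2 hB⟩

end Summit.CriticalPhenomena.CardyFormulaZ2.Cruxes.IKMixedBoxCrossing.DefectClosureExploration
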